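import Mathlib.RepresentationTheory.Homological.GroupCohomology.LowDegree
import Mathlib.Algebra.Field.ZMod
import HarnessLib

/-!
# Crux `PrintCFram.BottomClassIndexLawFiveLe` (stmt-BirchSwinnertonDyer-20372), line `eisenstein-resource-bdp-line` v7, stub
# `stub_kolyvaginUpper_borelCM` (S2), hypothesis (α): SAH'S LEMMA for a central element acting as a scalar `c` with `c − 1` invertible
# (cell `bsd-print-cfram`, width seat `bsd-line-cfram-p1-w4` g2; helper `--supports` 20372; THEOREMS ONLY, 0 facts, 0 definitions;
# pure group cohomology over Mathlib's `groupCohomology`)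

HONEST FRAMING. Nothing about BSD is proved; S2 is not proved. Hypothesis (α) of Kolyvagin's argument at the Borel CM-ramified prime
(Gross 1991 §9 / McCallum Prop. 3.1: `H¹(L(W[p])/L, W[p]) = 0`, so that Selmer classes restrict injectively to `Hom(Gal(L̄/L(W[p])), W[p])`)
is, by Sah's lemma, a consequence of ONE central element of `Gal(L(W[p])/L)` acting on `W[p]` as a scalar `c ≠ 1` — which the companion
file `…BorelNoPTorsionInputs.lean` supplies on the class (`BorelTorsion.exists_sq_mem_inertia_homothety`: `(τ²)^p ∈ I_𝔓`, a square of
`Γ_ℚ`, acts on all of `W[p](ℚ̄)` as `c = a^p ≡ ±2`). The tree's `Rank1Residual.Additive.KimThreeSahLemma` proves Sah's lemma for the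
scalar `−1` (`2 ∈ kˣ`); here the same four-line argument for an ARBITRARY central scalar `c` with `c − 1 ∈ kˣ`, in the same currency
(`Rep k G`, `groupCohomology.H1`):

* `coe_mem_coboundaries₁_of_central_of_actsAsScalar` — for a cocycle `f`, `f(zg) = c f(g) + f(z)` and `f(gz) = ρ(g) f(z) + f(g)`, so
  `(c − 1) f(g) = ρ(g) f(z) − f(z)`, i.e. `f = ∂v` with `v = (c − 1)⁻¹ f(z)`;
* `H1π_eq_zero_of_central_of_actsAsScalar`, `H1_eq_zero_of_central_of_actsAsScalar` — `H¹(G, A) = 0`.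
-- adapted from Summits/BirchSwinnertonDyer/Rank1Residual/Additive/KimThreeSahLemma.lean (the case `c = −1`).

For the consumer: with `G = Gal(L(W[p])/L)` (any quadratic `L`, or any Galois `L/ℚ` unramified at `p`), `A = W[p]` over `k = 𝔽_p`, and
`z` = the image of `(τ²)^p` (central because it is a homothety; `c − 1 ≢ 0`), this gives (α) at level `1`. beyond-print theorem: NO.
BSD is not proved by any of this; no summit statement is proved by this seat.

References: C.-H. Sah, *Automorphisms of finite groups*, J. Algebra 10 (1968); T. Lawson, C. Wuthrich, *Vanishing of some Galois
cohomology groups for elliptic curves*, in: Elliptic curves, modular forms and Iwasawa theory, Springer PROMS 188 (2016), §1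
[LawsonWuthrich2016]; B. H. Gross, LMS LNS 153 (1991), §9 [GrossLMS1991]; K. Rubin, PCMI 18 (2011), Lect. 2 §2.4 [Rubin2011PCMI].
-/

noncomputable section

universe u

-- the summit namespace `Summit.BirchSwinnertonDyer.BirchSwinnertonDyer` repeats the problem name by design (D-0017)
set_option linter.dupNamespace false

namespace Summit.BirchSwinnertonDyer.BirchSwinnertonDyer.Theorems.PrintCFram.BorelTorsion

open groupCohomology Rep

variable {k G : Type u} [CommRing k] [Group G] {A : Rep k G}

/-- **Sah's lemma, cocycle form (central scalar).** If `z` is central in `G` and acts on `A` as the scalar `c` with `c − 1 ∈ kˣ`, then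
every 1-cocycle `f : G → A` is the coboundary of `v = (c − 1)⁻¹ f(z)`: `f(g) = ρ(g)v − v`.
[cite: LawsonWuthrich2016, §1 (Sah's lemma)] [cite: Rubin2011PCMI, Lecture 2 §2.4 (H.3)] -/
theorem coe_mem_coboundaries₁_of_central_of_actsAsScalar (z : G) (hz : ∀ g : G, g * z = z * g) {c : k}
    (hρ : ∀ x : A, A.ρ z x = c • x) (hc : IsUnit (c - 1)) (f : cocycles₁ A) :
    (⇑f : G → A) ∈ coboundaries₁ A := by
  obtain ⟨u, hu⟩ := hc
  have hf := (mem_cocycles₁_iff (A := A) f).1 f.2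
  -- the key identity `(c - 1) • f g = ρ g (f z) - f z`
  have key : ∀ g : G, (c - 1) • f g = A.ρ g (f z) - f z := fun g => by
    have h1 : f (z * g) = A.ρ z (f g) + f z := hf z g
    have h2 : f (g * z) = A.ρ g (f z) + f g := hf g z
    rw [hz g, h1, hρ] at h2
    -- h2 : c • f g + f z = A.ρ g (f z) + f g
    rw [sub_smul, one_smul]
    calc c • f g - f g = (c • f g + f z) - f z - f g := by abel
      _ = (A.ρ g (f z) + f g) - f z - f g := by rw [h2]
      _ = A.ρ g (f z) - f z := by abel
  refine ⟨(↑u⁻¹ : k) • f z, funext fun g => ?_⟩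
  rw [d₀₁_hom_apply, map_smul, ← smul_sub, ← key g, smul_smul, ← hu, Units.inv_mul, one_smul]

/-- **Sah's lemma, class form (central scalar)**: the class of every 1-cocycle in `H¹(G, A)` vanishes.
[cite: LawsonWuthrich2016, §1 (Sah's lemma)] -/
theorem H1π_eq_zero_of_central_of_actsAsScalar (z : G) (hz : ∀ g : G, g * z = z * g) {c : k}
    (hρ : ∀ x : A, A.ρ z x = c • x) (hc : IsUnit (c - 1)) (f : cocycles₁ A) :
    H1π A f = 0 :=
  (H1π_eq_zero_iff f).2 (coe_mem_coboundaries₁_of_central_of_actsAsScalar z hz hρ hc f)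

/-- **Sah's lemma (central scalar)**: `H¹(G, A) = 0` when a central element of `G` acts on `A` as a scalar `c` with `c − 1` invertible —
the form in which hypothesis (α) `H¹(L(W[p])/L, W[p]) = 0` of Kolyvagin's argument follows, on the Borel CM-ramified class, from the
homothety `BorelTorsion.exists_sq_mem_inertia_homothety` (`c ≡ ±2`, `k = 𝔽_p`, `p ≥ 5`). [cite: LawsonWuthrich2016, §1 (Sah's lemma)]
[cite: GrossLMS1991, §9] -/
theorem H1_eq_zero_of_central_of_actsAsScalar (z : G) (hz : ∀ g : G, g * z = z * g) {c : k}
    (hρ : ∀ x : A, A.ρ z x = c • x) (hc : IsUnit (c - 1)) (x : H1 A) : x = 0 := by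
  induction x using H1_induction_on with
  | h f => exact H1π_eq_zero_of_central_of_actsAsScalar z hz hρ hc f

/-- In `𝔽_p`-coefficients (`k = ZMod p`): a central element acting as an INTEGER scalar `c ≢ 1 (mod p)` kills `H¹` — the exact output
shape of `BorelTorsion.exists_sq_mem_inertia_homothety` (`¬ (p : ℤ) ∣ c − 1`). [cite: LawsonWuthrich2016, §1 (Sah's lemma)] -/
theorem H1_eq_zero_of_central_of_actsAsIntScalar_zmod {p : ℕ} [Fact p.Prime] {G : Type} [Group G] {A : Rep (ZMod p) G}
    (z : G) (hz : ∀ g : G, g * z = z * g) {c : ℤ} (hρ : ∀ x : A, A.ρ z x = (c : ZMod p) • x)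
    (hc : ¬ (p : ℤ) ∣ c - 1) (x : H1 A) : x = 0 := by
  refine H1_eq_zero_of_central_of_actsAsScalar z hz hρ ?_ x
  rw [show ((c : ZMod p) - 1) = ((c - 1 : ℤ) : ZMod p) by push_cast; ring]
  have hne : ((c - 1 : ℤ) : ZMod p) ≠ 0 := by
    rw [Ne, ZMod.intCast_zmod_eq_zero_iff_dvd]
    exact hc
  exact hne.isUnit

end Summit.BirchSwinnertonDyer.BirchSwinnertonDyer.Theorems.PrintCFram.BorelTorsion

end
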